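import Mathlib
import HarnessLib
import Summits.AtomisticToContinuum.BoseEinsteinCondensation.Theses.BECStronglyRayleigh
import Literature.Combinatorics.StablePolynomials.KernelForm
import Literature.Combinatorics.StablePolynomials.Limits

/-!
# Sketch — first lemmas of the crux-idea cards for `GroundStateStability`
(stmt-AtomisticToContinuum-9672; ideator 1, round 1, generation 2)

Nothing deep is proved here; each `def … : Prop` is the first checkable statement of one line of
attack, stated over existing declarations only (they must elaborate, not be true by construction).
Two small arithmetic facts ARE proved (`xxzGate_triangle`, `kleinFour_eigs_nonpos_iff`), because
they are the cheapest falsifier of card A.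

Conventions (those of the crux): spin `½` (`n = 1`, local dimension `2`), index `0 = up =
occupied`; `H = xxzHamiltonian 1 G (-1) Δ + Σ_x μ_x S³_x`; a subset `S ⊆ Λ` is the configuration
`occ S` (up on `S`); the amplitude generating function is `p(z) = Σ_S ψ(occ S) z^S`.
-/

namespace Summit.AtomisticToContinuum.BoseEinsteinCondensation.Cruxes.GroundStateStability.Sketch

open Literature.MathematicalPhysics.QuantumLattice Literature.Combinatorics.StablePolynomials
open scoped BigOperators Topology
open Filter

noncomputable section

/-! ### Common vocabulary -/

/-- The product-basis configuration with spins up (= occupied) exactly on `S`. -/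
def occ {Λ : Type} [DecidableEq Λ] (S : Finset Λ) : TensorIndex Λ 2 :=
  fun x => if x ∈ S then 0 else 1

/-- The crux Hamiltonian `-(Σ_{xy∈E} S¹S¹+S²S²+ΔS³S³) + Σ_x μ_x S³_x`. -/
def cruxH {Λ : Type} [Fintype Λ] [DecidableEq Λ] (G : SimpleGraph Λ) [DecidableRel G.Adj]
    (Δ : ℝ) (μ : Λ → ℝ) : Op Λ 2 :=
  xxzHamiltonian 1 G (-1) Δ + ∑ x : Λ, ((μ x : ℝ) : ℂ) • siteSpin 1 x 2

/-- `ψ` is a ground vector of the magnetisation sector `M` (exactly the crux's hypothesis). -/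
def IsSectorGround {Λ : Type} [Fintype Λ] [DecidableEq Λ] (G : SimpleGraph Λ) [DecidableRel G.Adj]
    (Δ : ℝ) (μ : Λ → ℝ) (M : ℝ) (ψ : TensorIndex Λ 2 → ℂ) : Prop :=
  ψ ∈ spinZSector 1 M ∧ ψ ≠ 0 ∧
    (cruxH G Δ μ).mulVec ψ = ((lowestEnergyInSector 1 (cruxH G Δ μ) M : ℝ) : ℂ) • ψ

/-- `p(z) = Σ_S ψ(occ S) z^S`. -/
def ampPoly {Λ : Type} [Fintype Λ] [DecidableEq Λ] (ψ : TensorIndex Λ 2 → ℂ) (z : Λ → ℂ) : ℂ :=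
  ∑ S : Finset Λ, ψ (occ S) * ∏ x ∈ S, z x

/-- `∂_a p(z) = Σ_{S ∋ a} ψ(occ S) z^{S∖a}`. -/
def ampD1 {Λ : Type} [Fintype Λ] [DecidableEq Λ] (ψ : TensorIndex Λ 2 → ℂ) (a : Λ) (z : Λ → ℂ) : ℂ :=
  ∑ S : Finset Λ, if a ∈ S then ψ (occ S) * ∏ x ∈ S.erase a, z x else 0

/-- `∂_a ∂_b p(z) = Σ_{S ∋ a,b} ψ(occ S) z^{S∖{a,b}}` (`a ≠ b`; `0` on the diagonal). -/
def ampD2 {Λ : Type} [Fintype Λ] [DecidableEq Λ] (ψ : TensorIndex Λ 2 → ℂ) (a b : Λ) (z : Λ → ℂ) : ℂ :=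
  ∑ S : Finset Λ, if a ∈ S ∧ b ∈ S ∧ a ≠ b then ψ (occ S) * ∏ x ∈ (S.erase a).erase b, z x else 0

/-- The statement of the crux for ONE instance (so that partial results can be phrased). -/
def StableAt {Λ : Type} [Fintype Λ] [DecidableEq Λ] (ψ : TensorIndex Λ 2 → ℂ) : Prop :=
  ∀ z : Λ → ℂ, (∀ x, 0 < (z x).im) → ampPoly ψ z ≠ 0

/-! ## Card A — `six-vertex-euler-gates` (bond-local affine gates, Klein-four symbol) -/

/-- FIRST LEMMA (card A). The Borcea–Brändén symbol of the affine bond gate `1 - τ h_b` is the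
4-variable quadratic `a(z₁z₂ + w₁w₂) + b(z₁w₂ + z₂w₁) + s(z₁w₁ + z₂w₂)`; its coefficient matrix
is the Klein-four group matrix with eigenvalues `a+b+s, s-a-b, a-s-b, b-a-s`, so it is Lorentzian
(hence the form is stable) iff `(a, b, s)` satisfy the three triangle inequalities. Stated as the
stability conclusion. -/
def EulerGateSymbolStable : Prop :=
  ∀ a b s : ℝ, 0 ≤ a → 0 ≤ b → 0 ≤ s → 0 < a + b + s → s ≤ a + b → a ≤ b + s → b ≤ a + s →
    ∀ z₁ z₂ w₁ w₂ : ℂ, 0 < z₁.im → 0 < z₂.im → 0 < w₁.im → 0 < w₂.im →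
      (a : ℂ) * (z₁ * z₂ + w₁ * w₂) + (b : ℂ) * (z₁ * w₂ + z₂ * w₁) + (s : ℂ) * (z₁ * w₁ + z₂ * w₂) ≠ 0

/-- The XXZ gate weights: `a = 1 + τΔ/4` (both empty / both occupied), `b = 1 - τΔ/4` (one
occupied, stays), `s = τ/2` (one occupied, hops). They satisfy the hypotheses of
`EulerGateSymbolStable` iff `|Δ| ≤ 1` (given `0 < τ ≤ 4`): the six-vertex "triangle" window.
PROVED (cheapest falsifier of card A). -/
theorem xxzGate_triangle (Δ τ : ℝ) (hΔ : |Δ| ≤ 1) (hτ : 0 < τ) (hτ4 : τ ≤ 4) :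
    0 ≤ 1 + τ * Δ / 4 ∧ 0 ≤ 1 - τ * Δ / 4 ∧ (0 : ℝ) ≤ τ / 2 ∧
      0 < (1 + τ * Δ / 4) + (1 - τ * Δ / 4) + τ / 2 ∧
      τ / 2 ≤ (1 + τ * Δ / 4) + (1 - τ * Δ / 4) ∧
      1 + τ * Δ / 4 ≤ (1 - τ * Δ / 4) + τ / 2 ∧
      1 - τ * Δ / 4 ≤ (1 + τ * Δ / 4) + τ / 2 := by
  rcases abs_le.mp hΔ with ⟨h₁, h₂⟩
  have k₁ : -τ ≤ τ * Δ := by nlinarith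
  have k₂ : τ * Δ ≤ τ := by nlinarith
  refine ⟨by linarith, by linarith, by linarith, by linarith, by linarith, by linarith, by linarith⟩

/-- Converse direction of the window (sharpness at the gate level): if the hopping weight `τ/2`
dominates `|a - b| = τ|Δ|/2` fails, i.e. `|Δ| > 1`, one triangle inequality fails. PROVED. -/
theorem xxzGate_triangle_fails (Δ τ : ℝ) (hΔ : 1 < |Δ|) (hτ : 0 < τ) :
    ¬ (1 + τ * Δ / 4 ≤ (1 - τ * Δ / 4) + τ / 2 ∧ 1 - τ * Δ / 4 ≤ (1 + τ * Δ / 4) + τ / 2) := by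
  rintro ⟨h₁, h₂⟩
  have k₁ : τ * Δ ≤ τ := by linarith
  have k₂ : -τ ≤ τ * Δ := by linarith
  have hΔ1 : Δ ≤ 1 := by
    by_contra h; push Not at h; nlinarith
  have hΔ2 : -1 ≤ Δ := by
    by_contra h; push Not at h; nlinarith
  exact absurd (abs_le.mpr ⟨by linarith, hΔ1⟩) (not_le.mpr hΔ)

/-- The Klein-four spectrum: for the symmetric `4 × 4` matrix of the gate symbol (rows/cols
`z₁, z₂, w₁, w₂`), the three non-Perron eigenvalues are `≤ 0` iff the triangle inequalities hold —
recorded as the elementary real-arithmetic equivalence it is. PROVED. -/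
theorem kleinFour_eigs_nonpos_iff (a b s : ℝ) :
    (s - a - b ≤ 0 ∧ a - s - b ≤ 0 ∧ b - a - s ≤ 0) ↔ (s ≤ a + b ∧ a ≤ b + s ∧ b ≤ a + s) := by
  constructor <;> rintro ⟨h₁, h₂, h₃⟩ <;> exact ⟨by linarith, by linarith, by linarith⟩

/-- The affine bond gate `1 - τ h_{xy}` as a matrix on occupation subsets (`S'` = row, `S` =
column): identity off the bond; on the bond, weight `1 + τΔ/4` on `∅ ↦ ∅` and `{x,y} ↦ {x,y}`,
`1 - τΔ/4` on `{x} ↦ {x}`, `{y} ↦ {y}`, and `τ/2` on the hops `{x} ↦ {y}`, `{y} ↦ {x}`. -/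
def eulerGateKernel {Λ : Type} [DecidableEq Λ] (x y : Λ) (Δ τ : ℝ) (S' S : Finset Λ) : ℂ :=
  if S' \ {x, y} = S \ {x, y} then
    (if (x ∈ S' ↔ x ∈ S) ∧ (y ∈ S' ↔ y ∈ S) then
        (if (x ∈ S ↔ y ∈ S) then ((1 + τ * Δ / 4 : ℝ) : ℂ) else ((1 - τ * Δ / 4 : ℝ) : ℂ))
      else if (x ∈ S' ↔ y ∈ S) ∧ (y ∈ S' ↔ x ∈ S) then ((τ / 2 : ℝ) : ℂ) else 0)
  else 0

/-- GATE PRESERVER LEMMA (card A, kernel form = the hypothesis `hK` of the in-tree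
`multiAffine_kernel_stable_or_zero`): for `|Δ| ≤ 1` and `0 < τ ≤ 4` the symbol of the gate kernel
has no zero in `H^{2Λ}` (it factors as `∏_{i ∉ {x,y}} (zᵢ + wᵢ)` times the Klein-four quadratic).
Hence each gate maps zero-free coefficient families to zero-free-or-zero ones — with NO matrix
exponential and NO Borcea–Brändén necessity direction. -/
def EulerGatePreserves : Prop :=
  ∀ (Λ : Type) [Fintype Λ] [DecidableEq Λ] (x y : Λ), x ≠ y → ∀ Δ τ : ℝ, |Δ| ≤ 1 → 0 < τ → τ ≤ 4 →
    ∀ z w : Λ → ℂ, (∀ i, 0 < (z i).im) → (∀ i, 0 < (w i).im) →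
      (∑ S : Finset Λ, (∑ S' : Finset Λ, eulerGateKernel x y Δ τ S' S * ∏ i ∈ S', z i) *
          ∏ i ∈ Sᶜ, w i) ≠ 0

/-- The affine bond gate as an operator on the spin space: `1 - τ h_{xy}` with
`h_{xy} = -(S¹S¹ + S²S² + Δ S³S³)_{xy}` (so the gate is `1 + τ(S¹S¹ + S²S² + ΔS³S³)`). -/
def bondGate {Λ : Type} [Fintype Λ] [DecidableEq Λ] (x y : Λ) (Δ τ : ℝ) : Op Λ 2 :=
  1 + (τ : ℂ) • (spinBond 1 0 x y + spinBond 1 1 x y + (Δ : ℂ) • spinBond 1 2 x y)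

/-- One EULER SWEEP: the ordered product of the bond gates along a list of (oriented) edges,
followed by the diagonal field gates `1 - τ μ_x S³_x`. Entrywise nonnegative for
`τ ≤ min(4, 1/max|μ|)`, sector-preserving, primitive on each sector of a connected graph. -/
def sweepOp {Λ : Type} [Fintype Λ] [DecidableEq Λ] (l : List (Λ × Λ)) (Δ : ℝ) (μ : Λ → ℝ)
    (τ : ℝ) : Op Λ 2 :=
  (l.map fun e => bondGate e.1 e.2 Δ τ).prod *
    ((Finset.univ : Finset Λ).toList.map fun x => (1 : Op Λ 2) - ((τ * μ x : ℝ) : ℂ) • siteSpin 1 x 2).prod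

/-- SWEEP PERRON STABILITY (card A, the composite claim one level up): every nonnegative
eigenvector of a sweep inside a sector — i.e. its Perron vector, reached by power iteration from the
stable seed `e_N` through gates that preserve zero-freeness — has a stable generating polynomial. -/
def SweepPerronStable : Prop :=
  ∀ (Λ : Type) [Fintype Λ] [DecidableEq Λ] (G : SimpleGraph Λ) [DecidableRel G.Adj], G.Connected →
  ∀ (Δ : ℝ) (μ : Λ → ℝ), |Δ| ≤ 1 →
  ∀ l : List (Λ × Λ), (∀ e ∈ l, G.Adj e.1 e.2) → (∀ x y, G.Adj x y → (x, y) ∈ l ∨ (y, x) ∈ l) →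
  ∀ (M τ r : ℝ), 0 < τ → τ ≤ 1 → (∀ x, τ * |μ x| ≤ 1) → 0 < r →
  ∀ v : TensorIndex Λ 2 → ℂ, v ∈ spinZSector 1 M → v ≠ 0 → (∀ σ, 0 ≤ (v σ).re ∧ (v σ).im = 0) →
    (sweepOp l Δ μ τ).mulVec v = (r : ℂ) • v → StableAt v

/-- SWEEP PERRON LIMIT (card A, the only limit in the line): as `τ → 0⁺` the sector Perron vectors
of the sweep (`= 1 - τH + O(τ²)` on the sector) converge, after normalisation, to the sector ground
ray. Finite-dimensional eigenvector perturbation at a simple eigenvalue; no `τ → ∞`, no Trotter. -/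
def SweepPerronLimit : Prop :=
  ∀ (Λ : Type) [Fintype Λ] [DecidableEq Λ] (G : SimpleGraph Λ) [DecidableRel G.Adj], G.Connected →
  ∀ (Δ : ℝ) (μ : Λ → ℝ), |Δ| ≤ 1 →
  ∀ l : List (Λ × Λ), (∀ e ∈ l, G.Adj e.1 e.2) → (∀ x y, G.Adj x y → (x, y) ∈ l ∨ (y, x) ∈ l) →
  ∀ (M : ℝ) (ψ : TensorIndex Λ 2 → ℂ), IsSectorGround G Δ μ M ψ →
    ∃ (v : ℝ → TensorIndex Λ 2 → ℂ) (r : ℝ → ℝ) (c : ℂ), c ≠ 0 ∧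
      (∀ᶠ τ in 𝓝[>] (0 : ℝ), v τ ∈ spinZSector 1 M ∧ v τ ≠ 0 ∧ (∀ σ, 0 ≤ (v τ σ).re ∧ (v τ σ).im = 0) ∧
        0 < r τ ∧ (sweepOp l Δ μ τ).mulVec (v τ) = (r τ : ℂ) • v τ) ∧
      Tendsto v (𝓝[>] (0 : ℝ)) (𝓝 (c • ψ))

/-- How card A concludes (statement only; the proof is Hurwitz in coefficient form, in tree as
`eq_zero_or_isUpperHalfPlaneStable_of_tendsto_coeff`, plus `c • ψ ≠ 0`). -/
def CardA_Concludes : Prop :=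
  SweepPerronStable → SweepPerronLimit → Theses.BECStronglyRayleigh.GroundStateStability

/-! ## Card B — `heisenberg-point-deformation` (coherent-variable PDE; continuity from `Δ = 1`) -/

/-- The bond "diffusion coefficient" of `H` in coherent variables: `q_Δ(u,v) = ½(u²+v²) - Δuv`,
nonnegative on `ℝ²` iff `|Δ| ≤ 1` (positive definite iff `|Δ| < 1`). -/
def qΔ (Δ u v : ℝ) : ℝ := (u ^ 2 + v ^ 2) / 2 - Δ * u * v

/-- FIRST LEMMA (card B): the COHERENT-VARIABLE EIGEN-IDENTITY. Testing `Hψ = Eψ` against the real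
product vector `Φ(y) = ⊗_x (|↓⟩ + y_x |↑⟩)` writes `H` as a second-order differential operator on the
amplitude polynomial: for every eigenvector `ψ` (any eigenvalue `E`, any sector) and every real `y`,
`E·p(y) = Σ_{ab ∈ E} [q_Δ(y_a,y_b) ∂_a∂_b p - ½(y_b - Δy_a)∂_a p - ½(y_a - Δy_b)∂_b p - (Δ/4) p]
          + Σ_a μ_a (y_a ∂_a p - ½ p)`  (each edge counted once; below as `½ Σ_{a,b adjacent}`).
Its principal part `Σ q_Δ ∂_a∂_b` has nonnegative coefficients at every real point iff `|Δ| ≤ 1`. -/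
def CoherentEigenIdentity : Prop :=
  ∀ (Λ : Type) [Fintype Λ] [DecidableEq Λ] (G : SimpleGraph Λ) [DecidableRel G.Adj]
    (Δ : ℝ) (μ : Λ → ℝ) (E : ℝ) (ψ : TensorIndex Λ 2 → ℂ),
    (cruxH G Δ μ).mulVec ψ = (E : ℂ) • ψ →
    ∀ y : Λ → ℝ,
      let yc : Λ → ℂ := fun x => (y x : ℂ)
      (E : ℂ) * ampPoly ψ yc =
        (1 / 2 : ℂ) * (∑ a : Λ, ∑ b : Λ, if G.Adj a b then
            ((qΔ Δ (y a) (y b) : ℝ) : ℂ) * ampD2 ψ a b yc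
              - (((y b - Δ * y a) / 2 : ℝ) : ℂ) * ampD1 ψ a yc
              - (((y a - Δ * y b) / 2 : ℝ) : ℂ) * ampD1 ψ b yc
              - ((Δ / 4 : ℝ) : ℂ) * ampPoly ψ yc else 0) +
        ∑ a : Λ, ((μ a : ℝ) : ℂ) * ((y a : ℂ) * ampD1 ψ a yc - (1 / 2 : ℂ) * ampPoly ψ yc)

/-- CRITICAL-ZERO IDENTITY (card B, corollary of the eigen-identity): at a real point where `p` and
`∇p` vanish, `Σ_{ab∈E} q_Δ(y_a,y_b) ∂_a∂_b p(y) = 0` — a sum of (window-)nonnegative weights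
against the pair amplitudes seen from `y`. -/
def CriticalZeroIdentity : Prop :=
  ∀ (Λ : Type) [Fintype Λ] [DecidableEq Λ] (G : SimpleGraph Λ) [DecidableRel G.Adj]
    (Δ : ℝ) (μ : Λ → ℝ) (E : ℝ) (ψ : TensorIndex Λ 2 → ℂ),
    (cruxH G Δ μ).mulVec ψ = (E : ℂ) • ψ →
    ∀ y : Λ → ℝ,
      let yc : Λ → ℂ := fun x => (y x : ℂ)
      ampPoly ψ yc = 0 → (∀ a, ampD1 ψ a yc = 0) →
        (∑ a : Λ, ∑ b : Λ, if G.Adj a b then ((qΔ Δ (y a) (y b) : ℝ) : ℂ) * ampD2 ψ a b yc else 0) = 0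

/-- STABILITY-LOSS LEMMA (card B; pure geometry of polynomials, Gårding/ABG multiplicity): along a
continuous path of degree-`N` homogeneous multi-affine polynomials with POSITIVE coefficients on all
`N`-sets, starting real stable, if stability is ever lost then at the first loss time the (still
stable) polynomial has a nonzero REAL SINGULAR ZERO: `p(y) = 0` and `∇p(y) = 0`. -/
def StabilityLossLemma : Prop :=
  ∀ (σ : Type) [Fintype σ] [DecidableEq σ] (N : ℕ) (a : ℝ → Finset σ → ℝ),
    (∀ S, Continuous fun t => a t S) →
    (∀ t S, S.card ≠ N → a t S = 0) → (∀ t, 0 ≤ t → t ≤ 1 → ∀ S, S.card = N → 0 < a t S) →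
    IsRealStable (multiAffine (a 0)) → ¬ IsRealStable (multiAffine (a 1)) →
    ∃ t : ℝ, 0 ≤ t ∧ t ≤ 1 ∧ IsRealStable (multiAffine (a t)) ∧
      ∃ y : σ → ℝ, y ≠ 0 ∧
        MvPolynomial.eval y (multiAffine (a t)) = 0 ∧
        ∀ i, MvPolynomial.eval y (MvPolynomial.pderiv i (multiAffine (a t))) = 0

/-- TWO-PARTICLE NON-DEGENERACY (card B, the N = 2 payoff, all graphs / fields / |Δ| < 1): a
two-particle sector ground vector has NO nonzero real singular zero — by `CriticalZeroIdentity`,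
`∂_a∂_b p = ψ_{ab} > 0` (Perron) forces `q_Δ(y_a,y_b) = 0` on every edge, hence `y = 0` on a
connected graph when `|Δ| < 1`. (Sector of `2` up spins: `M = 2 - |Λ|/2`.) -/
def TwoParticleNoSingularZero : Prop :=
  ∀ (Λ : Type) [Fintype Λ] [DecidableEq Λ] (G : SimpleGraph Λ) [DecidableRel G.Adj], G.Connected →
  ∀ (Δ : ℝ) (μ : Λ → ℝ), |Δ| < 1 → ∀ ψ : TensorIndex Λ 2 → ℂ,
    IsSectorGround G Δ μ ((2 : ℝ) - (Fintype.card Λ : ℝ) / 2) ψ →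
    ∀ y : Λ → ℝ, y ≠ 0 →
      let yc : Λ → ℂ := fun x => (y x : ℂ)
      ampPoly ψ yc = 0 → ∃ a, ampD1 ψ a yc ≠ 0

/-- TWO-PARTICLE THEOREM S BY DEFORMATION (card B, consequence of the three statements above +
the anchor `Δ = 1, μ = 0` where `p = e₂`, + closure at `|Δ| = 1`): the crux restricted to the
two-particle sectors. -/
def TwoParticleStability : Prop :=
  ∀ (Λ : Type) [Fintype Λ] [DecidableEq Λ] (G : SimpleGraph Λ) [DecidableRel G.Adj], G.Connected →
  ∀ (Δ : ℝ) (μ : Λ → ℝ), |Δ| ≤ 1 → ∀ ψ : TensorIndex Λ 2 → ℂ,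
    IsSectorGround G Δ μ ((2 : ℝ) - (Fintype.card Λ : ℝ) / 2) ψ → StableAt ψ

/-- The anchor of the deformation: at the isotropic point `Δ = 1`, `μ = 0` every sector ground
vector of a connected graph is constant on its sector (maximal total spin), so `p = c · e_N`, which is
stable (`isUpperHalfPlaneStable_esymm` in tree). -/
def HeisenbergAnchor : Prop :=
  ∀ (Λ : Type) [Fintype Λ] [DecidableEq Λ] (G : SimpleGraph Λ) [DecidableRel G.Adj], G.Connected →
  ∀ (M : ℝ) (ψ : TensorIndex Λ 2 → ℂ), IsSectorGround G 1 (fun _ => 0) M ψ →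
    ∀ S T : Finset Λ, S.card = T.card → ψ (occ S) = ψ (occ T)

/-- Sanity: the instance-wise `StableAt` is literally the crux's conclusion, so card-level partial
results (`TwoParticleStability`) are comparable with the crux. PROVED (definitional). -/
theorem groundStateStability_iff_stableAt :
    Theses.BECStronglyRayleigh.GroundStateStability ↔
      ∀ (Λ : Type) [Fintype Λ] [DecidableEq Λ] (G : SimpleGraph Λ) [DecidableRel G.Adj], G.Connected →
        ∀ (Δ : ℝ) (μ : Λ → ℝ), |Δ| ≤ 1 → ∀ (M : ℝ) (ψ : TensorIndex Λ 2 → ℂ),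
          IsSectorGround G Δ μ M ψ → StableAt ψ := by
  constructor
  · intro h Λ _ _ G _ hG Δ μ hΔ M ψ hψ z hz
    exact h Λ G hG Δ μ hΔ M ψ hψ.1 hψ.2.1 hψ.2.2 z hz
  · intro h Λ _ _ G _ hG Δ μ hΔ M ψ h1 h2 h3 z hz
    exact h Λ G hG Δ μ hΔ M ψ ⟨h1, h2, h3⟩ z hz

end

end Summit.AtomisticToContinuum.BoseEinsteinCondensation.Cruxes.GroundStateStability.Sketch
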